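import Mathlib
import Summits.Ventures.PercRepro2.SwOutMixedArmsDefs

/-!
# The several-arms big-block lemma on the face `f = ⊥`: the core cube and the `2^R` slab cubes
(blind cell PercRepro2, night-4 g20, 2026-08-27; proofs/NIGHT4-G20.md §4)

On the face where every far arm is blue, the non-leaking points are the CORE cube
`coreR : (s, c) ↦ (s, c ∘ arm, c, c, ⊥)` and, for every set `A` of arms, the SLAB cube of the
piece `A`: `tbA A : (y, a, e) ↦` the point with `s = const y`, the arms of `A` ATTACHED (red on
top when `y = true`: all pieces red, u–p red, outside blue; blue at the bottom when `y = false`),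
the other arms free (pieces `a`, outside bits `e`, u–p edges of the colour opposite to `y`).  The
slab cube of `A` meets the core cube in exactly the antipodal pair `oPt A = F(⊤, 1_A)`,
`obPt A = F(⊥, 1_{Aᶜ})`, and a lower set with `G5` meets every slab cube in a lower set
(`tbA_mem_of_le`: lower the attached arms to dropped-red, apply `G5`, lower again).
-/

namespace Summit.Ventures.PercRepro2

namespace MixedArms

open scoped Classical

variable {ι ρ ν κ : Type*}

section Faces

/-- The face of the raw cube where the far arms outside `T` are blue. -/
def face (T : Finset κ) : Set (PtR ι ρ ν κ) := {p | ∀ k, k ∉ T → p.2.2.2.2 k = false}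

/-- Every point lies on the full face. -/
lemma mem_face_univ [Fintype κ] (p : PtR ι ρ ν κ) : p ∈ face Finset.univ := by
  intro k hk
  exact absurd (Finset.mem_univ k) hk

end Faces

section Flips

variable [DecidableEq κ]

/-- The partial flip: every coordinate except the far arms outside `T`. -/
def flipT (T : Finset κ) (p : PtR ι ρ ν κ) : PtR ι ρ ν κ :=
  (flipAll p.1, flipAll p.2.1, fun r => !p.2.2.1 r, fun r => !p.2.2.2.1 r,
    fun k => if k ∈ T then !p.2.2.2.2 k else p.2.2.2.2 k)

/-- The blue edge set relative to the face: the red set of the partial flip. -/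
def EBT (T : Finset κ) (p : PtR ι ρ ν κ) : Set (AtomR ι ρ ν κ) := ER (flipT T p)

/-- On the full face the partial flip is the total flip. -/
lemma flipT_univ [Fintype κ] (p : PtR ι ρ ν κ) : flipT Finset.univ p = flipPt p := by
  obtain ⟨s, a, uP, e, f⟩ := p
  simp only [flipT, flipPt, Finset.mem_univ, if_true]
  rfl

/-- On the full face the relative blue set is the blue set. -/
lemma EBT_univ [Fintype κ] (p : PtR ι ρ ν κ) : EBT Finset.univ p = EB p := by
  rw [EBT, flipT_univ]
  rfl

end Flips

section CoreCube

variable (arm : ν → ρ)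

/-- The core cube of the face `f = ⊥`: `(s, c) ↦ (s, c ∘ arm, c, c, ⊥)`. -/
def coreR (x : Config (ι ⊕ ρ)) : PtR ι ρ ν κ :=
  (fun j => x (Sum.inl j), fun i => x (Sum.inr (arm i)), fun r => x (Sum.inr r),
    fun r => x (Sum.inr r), fun _ => false)

/-- The projection onto the core cube: `(s, uP)`. -/
def projC (p : PtR ι ρ ν κ) : Config (ι ⊕ ρ) := Sum.elim p.1 p.2.2.1

/-- The point `F(⊥, ⊤)`: all u-arms blue, every arm attached red. -/
def bPt : PtR ι ρ ν κ := ((fun _ => false), (fun _ => true), (fun _ => true), (fun _ => true),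
  fun _ => false)

variable {arm}

/-- The core projection inverts the core cube. -/
lemma projC_coreR (x : Config (ι ⊕ ρ)) : projC (coreR arm x : PtR ι ρ ν κ) = x := by
  funext t
  rcases t with j | r <;> rfl

/-- A core point of the face is in the core cube. -/
lemma coreR_projC {p : PtR ι ρ ν κ} (hc : Core p arm) (hf : p ∈ face ∅) :
    coreR arm (projC p) = p := by
  obtain ⟨s, a, uP, e, f⟩ := p
  obtain ⟨ha, hu⟩ := hc
  simp only at ha hu
  simp only [coreR, projC, Sum.elim_inl, Sum.elim_inr]
  refine Prod.ext rfl (Prod.ext ?_ (Prod.ext rfl (Prod.ext ?_ ?_)))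
  · funext i
    exact (ha i).symm
  · funext r
    exact hu r
  · funext k
    exact (hf k (Finset.notMem_empty k)).symm

/-- The core cube lies on the face. -/
lemma coreR_mem_face (x : Config (ι ⊕ ρ)) : (coreR arm x : PtR ι ρ ν κ) ∈ face ∅ :=
  fun _ _ => rfl

/-- The core cube consists of core points. -/
lemma core_coreR (x : Config (ι ⊕ ρ)) : Core (coreR arm x : PtR ι ρ ν κ) arm :=
  ⟨fun _ => rfl, fun _ => rfl⟩

/-- The core cube is monotone. -/
lemma coreR_mono {x x' : Config (ι ⊕ ρ)} (h : x ≤ x') :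
    (coreR arm x : PtR ι ρ ν κ) ≤ coreR arm x' :=
  ⟨fun j => h (Sum.inl j), fun i => h (Sum.inr (arm i)), fun r => h (Sum.inr r),
    fun r => h (Sum.inr r), fun _ => le_rfl⟩

/-- The red set along the core cube is monotone. -/
lemma ER_coreR_mono {x x' : Config (ι ⊕ ρ)} (h : x ≤ x') :
    ER (coreR arm x : PtR ι ρ ν κ) ⊆ ER (coreR arm x') := ER_mono (coreR_mono h)

/-- The partial flip of the face commutes with the core cube. -/
lemma flipT_empty_coreR [DecidableEq κ] (x : Config (ι ⊕ ρ)) :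
    flipT ∅ (coreR arm x : PtR ι ρ ν κ) = coreR arm (flipAll x) := by
  refine Prod.ext ?_ (Prod.ext ?_ (Prod.ext ?_ (Prod.ext ?_ ?_)))
  · funext j
    rfl
  · funext i
    rfl
  · funext r
    rfl
  · funext r
    rfl
  · funext k
    simp only [flipT, coreR, Finset.notMem_empty, if_false]

/-- `F(⊥, ⊤)` is a core cube point. -/
lemma bPt_eq_coreR : (bPt : PtR ι ρ ν κ) = coreR arm (Sum.elim (fun _ => false) (fun _ => true)) := by
  rfl

end CoreCube

section SlabCubes

variable [DecidableEq ρ] (arm : ν → ρ) (A : Finset ρ)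

/-- The cube of the slab piece `A`: the slab bit, the pieces of the free arms and the outside bits
of the free arms. -/
abbrev CubeA := Unit ⊕ ({i : ν // arm i ∉ A} ⊕ {r : ρ // r ∉ A})

/-- The slab cube of the piece `A`. -/
def tbA (y : Config (CubeA arm A)) : PtR ι ρ ν κ :=
  (fun _ => y (Sum.inl ()),
    fun i => if h : arm i ∈ A then y (Sum.inl ()) else y (Sum.inr (Sum.inl ⟨i, h⟩)),
    fun r => if r ∈ A then y (Sum.inl ()) else !y (Sum.inl ()),
    fun r => if h : r ∈ A then y (Sum.inl ()) else y (Sum.inr (Sum.inr ⟨r, h⟩)),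
    fun _ => false)

/-- The slab bit of a point: the colour of a u-arm. -/
noncomputable def y0 [Nonempty ι] (p : PtR ι ρ ν κ) : Bool := p.1 (Classical.arbitrary ι)

/-- The index of a slab point: the arms whose u–p edges carry the slab's colour. -/
noncomputable def idxA [Nonempty ι] [Fintype ρ] (p : PtR ι ρ ν κ) : Finset ρ :=
  Finset.univ.filter fun r => p.2.2.1 r = y0 p

/-- The projection onto the cube of the slab piece `A`. -/
noncomputable def projA [Nonempty ι] (p : PtR ι ρ ν κ) : Config (CubeA arm A) :=
  Sum.elim (fun _ => y0 p) (Sum.elim (fun i => p.2.1 i.1) (fun r => p.2.2.2.1 r.1))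

/-- The top of the slab cube of `A`. -/
def tPt : PtR ι ρ ν κ := tbA arm A (fun _ => true)

/-- The overlap point `oPt A = F(⊤, 1_A)`. -/
def oPt : PtR ι ρ ν κ := tbA arm A (Sum.elim (fun _ => true) (fun _ => false))

/-- The overlap point `obPt A = F(⊥, 1_{Aᶜ})`. -/
def obPt : PtR ι ρ ν κ := tbA arm A (Sum.elim (fun _ => false) (fun _ => true))

variable {arm A}

/-- The slab bit of a slab cube point. -/
lemma y0_tbA [Nonempty ι] (y : Config (CubeA arm A)) :
    y0 (tbA arm A y : PtR ι ρ ν κ) = y (Sum.inl ()) := rfl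

/-- The slab projection inverts the slab cube. -/
lemma projA_tbA [Nonempty ι] (y : Config (CubeA arm A)) :
    projA arm A (tbA arm A y : PtR ι ρ ν κ) = y := by
  funext t
  rcases t with ⟨⟨⟩⟩ | ⟨i, hi⟩ | ⟨r, hr⟩
  · rfl
  · simp only [projA, tbA, Sum.elim_inl, Sum.elim_inr, dif_neg hi]
  · simp only [projA, tbA, Sum.elim_inr, dif_neg hr]

/-- The index of a slab cube point is `A`. -/
lemma idxA_tbA [Nonempty ι] [Fintype ρ] (y : Config (CubeA arm A)) :
    idxA (tbA arm A y : PtR ι ρ ν κ) = A := by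
  ext r
  rw [idxA, Finset.mem_filter, y0_tbA]
  simp only [Finset.mem_univ, true_and, tbA]
  by_cases h : r ∈ A
  · simp only [h, if_true]
  · simp only [h, if_false, iff_false]
    cases y (Sum.inl ()) <;> decide

/-- The slab cube lies on the face. -/
lemma tbA_mem_face (y : Config (CubeA arm A)) : (tbA arm A y : PtR ι ρ ν κ) ∈ face ∅ :=
  fun _ _ => rfl

/-- The slab cube consists of slab points. -/
lemma slab_tbA (y : Config (CubeA arm A)) :
    TSlab (tbA arm A y : PtR ι ρ ν κ) arm ∨ BSlab (tbA arm A y : PtR ι ρ ν κ) arm := by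
  cases h : y (Sum.inl ())
  · right
    refine ⟨by funext j; simp only [tbA, h], fun r => ?_⟩
    by_cases hr : r ∈ A
    · right
      refine ⟨fun i hi => ?_, ?_⟩
      · simp only [tbA, hi, hr, dif_pos, h]
      · simp only [tbA, hr, dif_pos, h]
    · left
      simp only [tbA, hr, if_false, h, Bool.not_false]
  · left
    refine ⟨by funext j; simp only [tbA, h], fun r => ?_⟩
    by_cases hr : r ∈ A
    · right
      refine ⟨fun i hi => ?_, ?_⟩
      · simp only [tbA, hi, hr, dif_pos, h]
      · simp only [tbA, hr, dif_pos, h]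
    · left
      simp only [tbA, hr, if_false, h, Bool.not_true]

/-- Slab cube points do not leak. -/
lemma not_leak_tbA (y : Config (CubeA arm A)) : ¬ Leak (tbA arm A y : PtR ι ρ ν κ) arm := by
  rcases slab_tbA (ι := ι) (κ := κ) (arm := arm) (A := A) y with h | h
  · exact not_leak_of_tslab arm h
  · exact not_leak_of_bslab arm h

/-- A slab point of the face with index `A` is in the slab cube of `A`. -/
lemma tbA_projA [Nonempty ι] [Fintype ρ] {p : PtR ι ρ ν κ} (hs : TSlab p arm ∨ BSlab p arm)
    (hf : p ∈ face ∅) (hA : idxA p = A) : tbA arm A (projA arm A p) = p := by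
  obtain ⟨s, a, uP, e, f⟩ := p
  have hA' : ∀ r, r ∈ A ↔ uP r = y0 (s, a, uP, e, f) := by
    intro r
    rw [← hA, idxA, Finset.mem_filter]
    simp only [Finset.mem_univ, true_and]
  have hff : f = fun _ => false := funext fun k => hf k (Finset.notMem_empty k)
  rcases hs with ⟨hs, hr⟩ | ⟨hs, hr⟩
  · simp only at hs hr
    have hy : y0 ((s, a, uP, e, f) : PtR ι ρ ν κ) = true := by
      simp only [y0, hs]
    refine Prod.ext ?_ (Prod.ext ?_ (Prod.ext ?_ (Prod.ext ?_ ?_)))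
    · funext j
      simp only [tbA, projA, Sum.elim_inl, hy]
      exact (congrFun hs j).symm
    · funext i
      simp only [tbA, projA, Sum.elim_inl, Sum.elim_inr, hy]
      split_ifs with h
      · rw [hA', hy] at h
        rcases hr (arm i) with h' | ⟨h', -⟩
        · rw [h] at h'
          exact absurd h' (by decide)
        · exact (h' i rfl).symm
      · rfl
    · funext r
      simp only [tbA, projA, Sum.elim_inl, hy, Bool.not_true]
      split_ifs with h
      · rw [hA', hy] at h
        exact h.symm
      · rw [hA', hy] at h
        cases hu : uP r
        · rfl
        · exact absurd hu h
    · funext r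
      simp only [tbA, projA, Sum.elim_inl, Sum.elim_inr, hy]
      split_ifs with h
      · rw [hA', hy] at h
        rcases hr r with h' | ⟨-, h'⟩
        · rw [h] at h'
          exact absurd h' (by decide)
        · exact h'.symm
      · rfl
    · simp only [tbA]
      exact hff.symm
  · simp only at hs hr
    have hy : y0 ((s, a, uP, e, f) : PtR ι ρ ν κ) = false := by
      simp only [y0, hs]
    refine Prod.ext ?_ (Prod.ext ?_ (Prod.ext ?_ (Prod.ext ?_ ?_)))
    · funext j
      simp only [tbA, projA, Sum.elim_inl, hy]
      exact (congrFun hs j).symm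
    · funext i
      simp only [tbA, projA, Sum.elim_inl, Sum.elim_inr, hy]
      split_ifs with h
      · rw [hA', hy] at h
        rcases hr (arm i) with h' | ⟨h', -⟩
        · rw [h] at h'
          exact absurd h' (by decide)
        · exact (h' i rfl).symm
      · rfl
    · funext r
      simp only [tbA, projA, Sum.elim_inl, hy, Bool.not_false]
      split_ifs with h
      · rw [hA', hy] at h
        exact h.symm
      · rw [hA', hy] at h
        cases hu : uP r
        · exact absurd hu h
        · rfl
    · funext r
      simp only [tbA, projA, Sum.elim_inl, Sum.elim_inr, hy]
      split_ifs with h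
      · rw [hA', hy] at h
        rcases hr r with h' | ⟨-, h'⟩
        · rw [h] at h'
          exact absurd h' (by decide)
        · exact h'.symm
      · rfl
    · simp only [tbA]
      exact hff.symm

/-- The red set along a slab cube is monotone (the dropped vertices of the free arms never count
there). -/
lemma ER_tbA_mono {y y' : Config (CubeA arm A)} (h : y ≤ y') :
    ER (tbA arm A y : PtR ι ρ ν κ) ⊆ ER (tbA arm A y') := by
  intro x hx
  rcases x with j | ⟨⟨⟩⟩ | i | r | k
  · rw [mem_ER_inl] at hx ⊢
    exact MixedPieces.true_le_imp (h (Sum.inl ())) hx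
  · rw [mem_ER_u] at hx ⊢
    obtain ⟨j, hj⟩ := hx
    exact ⟨j, MixedPieces.true_le_imp (h (Sum.inl ())) hj⟩
  · rw [mem_ER_a] at hx ⊢
    simp only [tbA] at hx ⊢
    split_ifs at hx ⊢ with hi
    · exact MixedPieces.true_le_imp (h (Sum.inl ())) hx
    · exact MixedPieces.true_le_imp (h _) hx
  · rw [mem_ER_p] at hx ⊢
    obtain ⟨⟨j, hj⟩, hp⟩ := hx
    simp only [tbA] at hj hp ⊢
    refine ⟨⟨j, MixedPieces.true_le_imp (h (Sum.inl ())) hj⟩, ?_⟩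
    split_ifs at hp ⊢ with hr
    · exact MixedPieces.true_le_imp (h (Sum.inl ())) hp
    · rw [hj] at hp
      exact absurd hp (by decide)
  · rw [mem_ER_f] at hx ⊢
    exact hx

/-- The partial flip of the face commutes with the slab cube. -/
lemma flipT_empty_tbA [DecidableEq κ] (y : Config (CubeA arm A)) :
    flipT ∅ (tbA arm A y : PtR ι ρ ν κ) = tbA arm A (flipAll y) := by
  refine Prod.ext ?_ (Prod.ext ?_ (Prod.ext ?_ (Prod.ext ?_ ?_)))
  · funext j
    rfl
  · funext i
    simp only [flipT, tbA, flipAll]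
    split_ifs <;> rfl
  · funext r
    simp only [flipT, tbA, flipAll]
    split_ifs <;> simp only [Bool.not_not]
  · funext r
    simp only [flipT, tbA, flipAll]
    split_ifs <;> rfl
  · funext k
    simp only [flipT, tbA, Finset.notMem_empty, if_false]

end SlabCubes

end MixedArms

end Summit.Ventures.PercRepro2
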